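import Literature.MathematicalPhysics.QuantumFieldTheory.ConformalBootstrap3D.MeanFieldSourcesAB
import Literature.MathematicalPhysics.QuantumFieldTheory.ConformalBootstrap3D.DecoupledPairNonVacuity
import Mathlib.Tactic
import HarnessLib

/-!
# The mixed mean-field decompositions with unequal dimensions, and the decoupled-pair witness on the quadrant

For two DECOUPLED generalised free fields `φ`, `χ` of dimensions `p, q > 1/2` in `d = 3` (`s = (p+q)/2`,
`Δ_σε = p - q` in the conventions of the `σ–ε` system with `σ = φ`, `ε = χ`), this file PROVES the two mixed
conformal block decompositions as `HasSum` identities on the open square `z, z̄ ∈ (0,1)`: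

  (I)  `u^s        = Σ_{n,ℓ} (-1)^ℓ P_{n,ℓ}(p,q) g^{Δ_σε,Δ_σε}_{p+q+2n+ℓ,ℓ}(z,z̄)`   (`hasSum_gffPair_blocks_I`, the
       ordering `⟨φχφχ⟩`, typed blocks `hrBlockAB (p-q) (p-q)` = `gmm`),
  (II) `u^s v^{-p} = Σ_{n,ℓ} P_{n,ℓ}(p,q) g^{-Δ_σε,Δ_σε}_{p+q+2n+ℓ,ℓ}(z,z̄)`         (`hasSum_gffPair_blocks_II`, the
       reflection-positive ordering `⟨χφφχ⟩`, blocks `hrBlockAB (-(p-q)) (p-q)` = `gpm`),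

with the Fitzpatrick–Kaplan coefficients `P = mftCoeffAB` (§2.2 at `(Δ₁,Δ₂) = (p,q)`, `h = 3/2`; all `> 0`), from
the formal identities of `MeanFieldSourcesAB` (Casimir-pair closure) exactly as `MeanFieldDecomposition` does in
the equal case:

1. (§§1–2, finite algebra) `hrMonomialCoeffAB_shift` and the two degree identities `mftAB_degree_identity_I/II`
   (coefficient of `(z z̄)^s z^i z̄^k`: `δ_{N,0}` resp. `(p)_i (p)_k/(i! k!)`, via `gg_conversion`);
2. (§§3–4, analysis) Tonelli on the NON-NEGATIVE family of (II) (`hrMonomialCoeffAB_self_nonneg`: the `a = b`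
   array is `≥ 0`) against the binomial series (`hasSum_mftII_series`); for the sign-indefinite family of (I)
   absolute summability by the coefficient-level Cauchy–Schwarz bound `|k^{(a,-a)}| ≤ (k^{(a,a)} + k^{(-a,-a)})/2`
   (`abs_hrMonomialCoeffAB_neg_le`, from `abs_hrCoeffAB_neg_le`) and the (II) families at `(q,p)` and `(p,q)`,
   then fibrewise summation (`hasSum_mftI_series`);
3. (§5) multiplication by `(z z̄)^s`;
4. (§6) **the witness**: `gffPair p q := gffPairData p q (P_{·,·}(p,q))` satisfies the FULL typed axioms A1–A4
   (`gffPair_satisfiesBootstrapAxioms`, by the assembly theorem `gffPairData_satisfiesBootstrapAxioms` of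
   `DecoupledPairNonVacuity`) whenever `p + q ≥ 3`, `2q ≥ 3` and `2p ≥ 3 ∨ 2p = q`; in particular on the whole
   closed QUADRANT `p, q ≥ 3/2` (`gffPair_satisfiesBootstrapAxioms_of_ge`) and on the generalised-free SEGMENT
   `(Δ_σ, Δ_ε) = (p, 2p)`, `p ≥ 1` (`gffLine_satisfiesBootstrapAxioms` — the window statement of
   `SigmaEpsilonSystem`'s docstring, realised by the pair `(φ, χ_{2p})` instead of `(φ, φ²)`). Consequences:
   `BoxExcluded.not_mem_of_ge` (no certificate over the typed axioms excludes a box meeting `[3/2,∞)²`),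
   `BoxExcluded.gffLine_not_mem` (`(p,2p) ∉ Q` for `p ≥ 1`), `IsingEnclosure.mem_of_ge`, `IsingEnclosure.gffLine_mem`.

Decoupled generalised free fields are unitary CFT data (Heemskerk–Penedones–Polchinski–Sully 2009 §2;
Fitzpatrick–Kaplan 2012 §2.2); that they fill the bulk region of the mixed-correlator numerics is
Kos–Poland–Simmons-Duffin 2014 §5.3. Nothing here is a statement about the 3D Ising CFT. The proof method
(Casimir-pair closure for unequal dimensions) is ours; validation before formalisation: pub-ising3d-lit-g10
`code/ab_*.py` (exact rationals / sympy).

References: A. L. Fitzpatrick, J. Kaplan, JHEP 10 (2012) 032, §2.2 [cite: FitzpatrickKaplan2012, §2.2];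
I. Heemskerk, J. Penedones, J. Polchinski, J. Sully, JHEP 10 (2009) 079, §2 [cite: HeemskerkPenedonesPolchinskiSully2009, §2];
F. A. Dolan, H. Osborn, Nucl. Phys. B 678 (2004) 491, §3 eqs. (3.9)–(3.12) [cite: DolanOsborn2004, §3 eqs. (3.9)–(3.12)];
F. Kos, D. Poland, D. Simmons-Duffin, JHEP 11 (2014) 109, §5.3 [cite: KosPolandSimmonsduffin2014, §5.3].
-/

namespace Literature.MathematicalPhysics.QuantumFieldTheory.ConformalBootstrap3D

open Finset Set Filter Topology

/-! ### 1. The `(a,b)` block arrays in the common monomial frame -/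

/-- **The block `(2s+2n+ℓ, ℓ)` with parameters `(a,b)` in the common frame**: its monomial array shifted by
`(z z̄)^n`, `[n ≤ i, n ≤ k] · k^{(a,b)}_{(i-n,k-n)}`, equals `Σ_j blockArrAB a b s n ℓ N j / λ_ℓ · e_{N,j}(i,k)`
(`N = i + k`). [cite: DolanOsborn2004, §3 eqs. (3.10)–(3.11)] -/
theorem hrMonomialCoeffAB_shift (a b s : ℝ) (n ℓ i k N : ℕ) (hN : i + k = N) :
    (if n ≤ i ∧ n ≤ k then hrMonomialCoeffAB a b (2 * s + 2 * n + ℓ) ℓ (i - n, k - n) else 0) =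
      ∑ j ∈ range (N + 1), blockArrAB a b s n ℓ N j / legendreLam ℓ * legendreArrDeg N j (i, k) := by
  by_cases hn : n ≤ i ∧ n ≤ k
  · rw [if_pos hn]
    by_cases hℓ : 2 * n + ℓ ≤ N
    · rw [hrMonomialCoeffAB_eq_slice _ _ _ _ (N := N - 2 * n) (by simp only; omega) (by omega)]
      unfold hrSliceAB
      have hext : ∑ j ∈ range (N + 1), blockArrAB a b s n ℓ N j / legendreLam ℓ * legendreArrDeg N j (i, k) =
          ∑ j ∈ range (N - 2 * n + 1), blockArrAB a b s n ℓ N j / legendreLam ℓ * legendreArrDeg N j (i, k) := by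
        refine (sum_subset (range_subset_range.mpr (by omega)) fun j hj hj' => ?_).symm
        rw [Finset.mem_range] at hj hj'
        have h0 : blockArrAB a b s n ℓ N j = 0 := by
          unfold blockArrAB
          apply hrCoeffZAB_eq_zero_of_not_inRangeZ
          rintro ⟨-, -, h3, -⟩
          push_cast at h3
          omega
        rw [h0, zero_div, zero_mul]
      rw [hext]
      refine sum_congr rfl fun j hj => ?_
      rw [Finset.mem_range] at hj
      have hb : blockArrAB a b s n ℓ N j = hrCoeffAB a b (2 * s + 2 * n + ℓ) ℓ (N - 2 * n - ℓ) j := by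
        unfold blockArrAB
        rw [show ((N : ℤ)) - ((2 * n + ℓ : ℕ) : ℤ) = ((N - 2 * n - ℓ : ℕ) : ℤ) by push_cast; omega,
          hrCoeffZAB_natCast]
      rw [hb, legendreArrDeg_shift hN hn.1 hn.2 (by omega)]
    · rw [hrMonomialCoeffAB_eq_zero_of_lt _ _ _ _ (by simp only; omega)]
      symm
      refine sum_eq_zero fun j _ => ?_
      rw [blockArrAB_eq_zero_of_lt a b s (by push_cast; omega), zero_div, zero_mul]
  · rw [if_neg hn]
    symm
    refine sum_eq_zero fun j hj => ?_
    rw [Finset.mem_range] at hj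
    by_cases he : legendreArrDeg N j (i, k) = 0
    · rw [he, mul_zero]
    · have hcond : j ≤ N ∧ (N + j) % 2 = 0 ∧ (N - j) / 2 ≤ i ∧ (N - j) / 2 ≤ k := by
        unfold legendreArrDeg at he
        by_cases hc : j ≤ N ∧ (N + j) % 2 = 0
        · rw [if_pos hc] at he
          refine ⟨hc.1, hc.2, ?_, ?_⟩ <;> by_contra hlt <;> apply he <;>
            exact legendreArr_pair_eq_zero _ j i k (by omega)
        · exfalso; apply he; rw [if_neg hc]; rfl
      have h0 : blockArrAB a b s n ℓ N j = 0 := by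
        unfold blockArrAB
        by_cases hlev : (2 * n + ℓ : ℕ) ≤ (N : ℤ)
        · apply hrCoeffZAB_eq_zero_of_not_inRangeZ
          rintro ⟨-, -, h3, -⟩
          push_cast at h3 hlev
          omega
        · exact hrCoeffZAB_of_neg_left _ _ _ _ (by omega) _
      rw [h0, zero_div, zero_mul]

/-- `blockSumAB` is additive in the coefficient family. [folklore] -/
theorem blockSumAB_add (a b s : ℝ) (c c' : ℕ → ℕ → ℝ) (M j : ℤ) :
    blockSumAB a b s (fun n ℓ => c n ℓ + c' n ℓ) M j = blockSumAB a b s c M j + blockSumAB a b s c' M j := by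
  unfold blockSumAB
  simp only [add_mul, sum_add_distrib]

/-! ### 2. The two degree identities -/

/-- **The degree identity of the `⟨εσσε⟩` family** (II): for every `(i, k)` (`N = i + k`; `p, q > 1/2`;
`s = (p+q)/2`, `a = (p-q)/2`),
`Σ_{n ≤ N} Σ_{ℓ ≤ N} P_{n,ℓ}(p,q) · [n ≤ i, n ≤ k] k^{(a,a)}_{(2s+2n+ℓ,ℓ);(i-n,k-n)} = (p)_i (p)_k/(i! k!)` — the coefficient of
`(z z̄)^s z^i z̄^k` in `u^s v^{-p} = Σ P_{n,ℓ}(p,q) g^{(a,a)}`. [cite: FitzpatrickKaplan2012, §2.2] -/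
theorem mftAB_degree_identity_II {p q : ℝ} (hp : 1 / 2 < p) (hq : 1 / 2 < q) (i k N : ℕ) (hN : i + k = N) :
    ∑ n ∈ range (N + 1), ∑ ℓ ∈ range (N + 1), mftCoeffAB p q n ℓ *
        (if n ≤ i ∧ n ≤ k then
          hrMonomialCoeffAB ((p - q) / 2) ((p - q) / 2) (2 * ((p + q) / 2) + 2 * n + ℓ) ℓ (i - n, k - n) else 0) =
      poch p i * poch p k / ((i.factorial : ℝ) * k.factorial) := by
  set a := (p - q) / 2 with ha
  set s := (p + q) / 2 with hs
  have step1 : ∀ n ∈ range (N + 1), ∑ ℓ ∈ range (N + 1), mftCoeffAB p q n ℓ *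
      (if n ≤ i ∧ n ≤ k then hrMonomialCoeffAB a a (2 * s + 2 * n + ℓ) ℓ (i - n, k - n) else 0) =
      ∑ j ∈ range (N + 1), ∑ ℓ ∈ range (N + 1),
        (mftCoeffAB p q n ℓ / legendreLam ℓ * blockArrAB a a s n ℓ N j) * legendreArrDeg N j (i, k) := by
    intro n _
    rw [sum_comm]
    refine sum_congr rfl fun ℓ _ => ?_
    rw [hrMonomialCoeffAB_shift a a s n ℓ i k N hN, mul_sum]
    refine sum_congr rfl fun j _ => ?_
    ring
  rw [sum_congr rfl step1, sum_comm]
  have step2 : ∀ j ∈ range (N + 1), ∑ n ∈ range (N + 1), ∑ ℓ ∈ range (N + 1),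
      (mftCoeffAB p q n ℓ / legendreLam ℓ * blockArrAB a a s n ℓ N j) * legendreArrDeg N j (i, k) =
      ggArr p N j * legendreArrDeg N j (i, k) := by
    intro j _
    rw [← congrFun (congrFun (blockSumAB_mftII_eq_ggArr hp hq) N) j]
    unfold blockSumAB
    rw [Int.toNat_natCast, sum_mul]
    refine sum_congr rfl fun n _ => ?_
    rw [sum_mul]
  rw [sum_congr rfl step2, gg_conversion hp i k N hN]

/-- **The degree identity of the `⟨σεσε⟩` family** (I): for every `(i, k)` (`N = i + k`; `p, q > 1/2`;
`s = (p+q)/2`, `(a,b) = ((q-p)/2, (p-q)/2)`),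
`Σ_{n ≤ N} Σ_{ℓ ≤ N} (-1)^ℓ P_{n,ℓ}(p,q) · [n ≤ i, n ≤ k] k^{(a,b)}_{(2s+2n+ℓ,ℓ);(i-n,k-n)} = δ_{N,0}` — the coefficient of
`(z z̄)^s z^i z̄^k` in `u^s = Σ (-1)^ℓ P_{n,ℓ}(p,q) g^{(a,-a)}`. [cite: FitzpatrickKaplan2012, §2.2] -/
theorem mftAB_degree_identity_I {p q : ℝ} (hp : 1 / 2 < p) (hq : 1 / 2 < q) (i k N : ℕ) (hN : i + k = N) :
    ∑ n ∈ range (N + 1), ∑ ℓ ∈ range (N + 1), (-1 : ℝ) ^ ℓ * mftCoeffAB p q n ℓ *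
        (if n ≤ i ∧ n ≤ k then
          hrMonomialCoeffAB ((q - p) / 2) ((p - q) / 2) (2 * ((p + q) / 2) + 2 * n + ℓ) ℓ (i - n, k - n) else 0) =
      if N = 0 then 1 else 0 := by
  set a := (q - p) / 2 with ha
  set b := (p - q) / 2 with hb
  set s := (p + q) / 2 with hs
  have step1 : ∀ n ∈ range (N + 1), ∑ ℓ ∈ range (N + 1), (-1 : ℝ) ^ ℓ * mftCoeffAB p q n ℓ *
      (if n ≤ i ∧ n ≤ k then hrMonomialCoeffAB a b (2 * s + 2 * n + ℓ) ℓ (i - n, k - n) else 0) =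
      ∑ j ∈ range (N + 1), ∑ ℓ ∈ range (N + 1),
        ((-1 : ℝ) ^ ℓ * mftCoeffAB p q n ℓ / legendreLam ℓ * blockArrAB a b s n ℓ N j) * legendreArrDeg N j (i, k) := by
    intro n _
    rw [sum_comm]
    refine sum_congr rfl fun ℓ _ => ?_
    rw [hrMonomialCoeffAB_shift a b s n ℓ i k N hN, mul_sum]
    refine sum_congr rfl fun j _ => ?_
    ring
  rw [sum_congr rfl step1, sum_comm]
  have step2 : ∀ j ∈ range (N + 1), ∑ n ∈ range (N + 1), ∑ ℓ ∈ range (N + 1),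
      ((-1 : ℝ) ^ ℓ * mftCoeffAB p q n ℓ / legendreLam ℓ * blockArrAB a b s n ℓ N j) * legendreArrDeg N j (i, k) =
      deltaArr N j * legendreArrDeg N j (i, k) := by
    intro j _
    rw [← congrFun (congrFun (blockSumAB_mftI_eq_delta hp hq) N) j]
    unfold blockSumAB
    rw [Int.toNat_natCast, sum_mul]
    refine sum_congr rfl fun n _ => ?_
    rw [sum_mul]
  rw [sum_congr rfl step2, sum_deltaArr_mul_legendreArrDeg i k N hN]

/-! ### 3. The rows: shifted `(a,b)` block series -/

/-- The `z`-series of an `(a,b)` block strictly above the unitarity bound, as a `HasSum` on the open square.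
[cite: DolanOsborn2004, §3 eqs. (3.10)–(3.11)] -/
theorem hasSum_hrMonomialCoeffAB (a b : ℝ) {Δ : ℝ} {ℓ : ℕ} (hΔ : unitarityBound3D ℓ < Δ) {z zb : ℝ}
    (hz : z ∈ Ioo (0 : ℝ) 1) (hzb : zb ∈ Ioo (0 : ℝ) 1) :
    HasSum (fun q : ℕ × ℕ => hrMonomialCoeffAB a b Δ ℓ q * z ^ q.1 * zb ^ q.2) (hrSeriesAB a b Δ ℓ z zb) := by
  have h := (isDoublePowerSeriesOn_hrSeriesAB (a := a) (b := b) hΔ z zb (by rw [abs_of_pos hz.1]; exact hz.2)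
    (by rw [abs_of_pos hzb.1]; exact hzb.2)).1
  have hsum : Summable fun q : ℕ × ℕ => hrMonomialCoeffAB a b Δ ℓ q * z ^ q.1 * zb ^ q.2 := by
    refine Summable.of_norm ?_
    refine h.congr fun q => ?_
    rw [Real.norm_eq_abs, abs_mul, abs_mul, abs_pow, abs_pow]
  exact hsum.hasSum

/-- **An `(a,b)` block series shifted by `(z z̄)^n`** as a double power series: the coefficient of `z^i z̄^k` is
`[n ≤ i, n ≤ k] k^{(a,b)}_{(i-n, k-n)}`. [cite: DolanOsborn2004, §3 eqs. (3.10)–(3.11)] -/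
theorem hasSum_hrMonomialCoeffAB_shift (a b : ℝ) {Δ : ℝ} {ℓ : ℕ} (hΔ : unitarityBound3D ℓ < Δ) (n : ℕ) {z zb : ℝ}
    (hz : z ∈ Ioo (0 : ℝ) 1) (hzb : zb ∈ Ioo (0 : ℝ) 1) :
    HasSum (fun q : ℕ × ℕ =>
        (if n ≤ q.1 ∧ n ≤ q.2 then hrMonomialCoeffAB a b Δ ℓ (q.1 - n, q.2 - n) else 0) * z ^ q.1 * zb ^ q.2)
      ((z * zb) ^ n * hrSeriesAB a b Δ ℓ z zb) := by
  set f : ℕ × ℕ → ℝ := fun q =>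
    (if n ≤ q.1 ∧ n ≤ q.2 then hrMonomialCoeffAB a b Δ ℓ (q.1 - n, q.2 - n) else 0) * z ^ q.1 * zb ^ q.2 with hf
  set g : ℕ × ℕ → ℕ × ℕ := fun q => (q.1 + n, q.2 + n) with hg
  have hginj : Function.Injective g := by
    intro u v h
    simp only [hg, Prod.mk.injEq] at h
    exact Prod.ext (by omega) (by omega)
  have hzero : ∀ x ∉ Set.range g, f x = 0 := by
    intro x hx
    have hx' : ¬ (n ≤ x.1 ∧ n ≤ x.2) := by
      rintro ⟨h1, h2⟩
      exact hx ⟨(x.1 - n, x.2 - n), by simp only [hg]; exact Prod.ext (by omega) (by omega)⟩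
    simp only [hf, if_neg hx', zero_mul]
  rw [← hginj.hasSum_iff hzero]
  have hcomp : f ∘ g = fun q : ℕ × ℕ => (z * zb) ^ n * (hrMonomialCoeffAB a b Δ ℓ q * z ^ q.1 * zb ^ q.2) := by
    funext q
    simp only [Function.comp, hf, hg, if_pos (And.intro (Nat.le_add_left n q.1) (Nat.le_add_left n q.2)),
      Nat.add_sub_cancel, pow_add, mul_pow]
    ring
  rw [hcomp]
  exact (hasSum_hrMonomialCoeffAB a b hΔ hz hzb).mul_left _

/-! ### 4. The `(u/v)`-type family (II): Tonelli on a non-negative family -/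

/-- The four-index family of the `⟨εσσε⟩` decomposition (monomial index `q = (i,k)`, operator index `m = (n,ℓ)`):
`P_{n,ℓ}(p,q) · [n ≤ i,k] k^{(a,a)}_{(2s+2n+ℓ,ℓ);(i-n,k-n)} · z^i z̄^k`, `a = (p-q)/2`, `s = (p+q)/2`. [folklore] -/
noncomputable def mftIIFamily (p q z zb : ℝ) (qm : (ℕ × ℕ) × (ℕ × ℕ)) : ℝ :=
  mftCoeffAB p q qm.2.1 qm.2.2 *
    ((if qm.2.1 ≤ qm.1.1 ∧ qm.2.1 ≤ qm.1.2 then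
        hrMonomialCoeffAB ((p - q) / 2) ((p - q) / 2) (2 * ((p + q) / 2) + 2 * qm.2.1 + qm.2.2) qm.2.2
          (qm.1.1 - qm.2.1, qm.1.2 - qm.2.1) else 0) *
      z ^ qm.1.1 * zb ^ qm.1.2)

/-- The odd-sector double-twist points are strictly above the unitarity bound (frame form). [folklore] -/
theorem pair_unitarity' {p q : ℝ} (hp : 1 / 2 < p) (hq : 1 / 2 < q) (n ℓ : ℕ) :
    unitarityBound3D ℓ < 2 * ((p + q) / 2) + 2 * (n : ℝ) + (ℓ : ℝ) :=
  unitarityBound3D_lt_twist (p := (p + q) / 2) (by linarith) n ℓ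

/-- The `⟨εσσε⟩` family is non-negative on the square (`a = b`). [folklore] -/
theorem mftIIFamily_nonneg {p q : ℝ} (hp : 1 / 2 < p) (hq : 1 / 2 < q) {z zb : ℝ} (hz : 0 ≤ z) (hzb : 0 ≤ zb) :
    0 ≤ mftIIFamily p q z zb := by
  intro qm
  simp only [mftIIFamily, Pi.zero_apply]
  refine mul_nonneg (mftCoeffAB_nonneg hp hq _ _)
    (mul_nonneg (mul_nonneg ?_ (pow_nonneg hz _)) (pow_nonneg hzb _))
  split_ifs
  · exact hrMonomialCoeffAB_self_nonneg _ (pair_unitarity' hp hq _ _) _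
  · exact le_rfl

/-- **The `⟨εσσε⟩` family is summable with fibrewise sums the binomial coefficients and total
`(1-z)^{-p}(1-z̄)^{-p}`** (Tonelli; `z, z̄ ∈ (0,1)`, `p, q > 1/2`). [cite: FitzpatrickKaplan2012, §2.2] -/
theorem hasSum_mftIIFamily {p q : ℝ} (hp : 1 / 2 < p) (hq : 1 / 2 < q) {z zb : ℝ} (hz : z ∈ Ioo (0 : ℝ) 1)
    (hzb : zb ∈ Ioo (0 : ℝ) 1) :
    Summable (mftIIFamily p q z zb) ∧
      HasSum (mftIIFamily p q z zb) (1 / (1 - z) ^ p * (1 / (1 - zb) ^ p)) := by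
  set F := mftIIFamily p q z zb with hF
  set V : ℕ × ℕ → ℝ := fun u =>
    poch p u.1 * poch p u.2 / ((u.1.factorial : ℝ) * u.2.factorial) * (z ^ u.1 * zb ^ u.2) with hV
  -- fibre sums over the operator index: the degree identity
  have hinner : ∀ u : ℕ × ℕ, HasSum (fun m => F (u, m)) (V u) := by
    intro u
    set N := u.1 + u.2 with hN
    have hzero : ∀ m ∉ range (N + 1) ×ˢ range (N + 1), F (u, m) = 0 := by
      intro m hm
      rw [Finset.mem_product, Finset.mem_range, Finset.mem_range, not_and_or, not_lt, not_lt] at hm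
      simp only [hF, mftIIFamily]
      rcases hm with h1 | h2
      · rw [if_neg (by omega)]; ring
      · split_ifs with hc
        · rw [hrMonomialCoeffAB_eq_zero_of_lt _ _ _ _ (by simp only; omega)]; ring
        · ring
    have hfin : HasSum (fun m => F (u, m)) (∑ m ∈ range (N + 1) ×ˢ range (N + 1), F (u, m)) :=
      hasSum_sum_of_ne_finset_zero hzero
    have hval : ∑ m ∈ range (N + 1) ×ˢ range (N + 1), F (u, m) = V u := by
      rw [Finset.sum_product, hV]
      simp only
      rw [← mftAB_degree_identity_II hp hq u.1 u.2 N hN.symm, sum_mul]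
      refine sum_congr rfl fun n _ => ?_
      rw [sum_mul]
      refine sum_congr rfl fun ℓ _ => ?_
      simp only [hF, mftIIFamily]
      ring
    rwa [hval] at hfin
  -- the fibre sums form the Cauchy square of the binomial series
  have hVsum : HasSum V (1 / (1 - z) ^ p * (1 / (1 - zb) ^ p)) := by
    have h1 := hasSum_poch_div_factorial_mul_pow p (x := z) (by rw [abs_of_pos hz.1]; exact hz.2)
    have h2 := hasSum_poch_div_factorial_mul_pow p (x := zb) (by rw [abs_of_pos hzb.1]; exact hzb.2)
    have hp0 : 0 < p := by linarith
    have hnn1 : 0 ≤ fun n => poch p n / (n.factorial : ℝ) * z ^ n := fun n =>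
      mul_nonneg (div_nonneg (poch_pos hp0 n).le (by positivity)) (pow_nonneg hz.1.le n)
    have hnn2 : 0 ≤ fun n => poch p n / (n.factorial : ℝ) * zb ^ n := fun n =>
      mul_nonneg (div_nonneg (poch_pos hp0 n).le (by positivity)) (pow_nonneg hzb.1.le n)
    have hprod := h1.mul h2 (h1.summable.mul_of_nonneg h2.summable hnn1 hnn2)
    have hVeq : V = fun u : ℕ × ℕ =>
        poch p u.1 / (u.1.factorial : ℝ) * z ^ u.1 * (poch p u.2 / (u.2.factorial : ℝ) * zb ^ u.2) := by
      funext u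
      simp only [hV]
      ring
    rw [hVeq]
    exact hprod
  have hFnn : 0 ≤ F := mftIIFamily_nonneg hp hq hz.1.le hzb.1.le
  have hFsum : Summable F := by
    refine (summable_prod_of_nonneg hFnn).mpr ⟨fun u => (hinner u).summable, ?_⟩
    have : (fun u : ℕ × ℕ => ∑' m, F (u, m)) = V := funext fun u => (hinner u).tsum_eq
    rw [this]
    exact hVsum.summable
  refine ⟨hFsum, ?_⟩
  have htot : HasSum F (∑' qm, F qm) := hFsum.hasSum
  have hval : ∑' qm, F qm = 1 / (1 - z) ^ p * (1 / (1 - zb) ^ p) :=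
    (htot.prod_fiberwise hinner).unique hVsum
  rwa [hval] at htot

/-- **The `⟨εσσε⟩` decomposition, `z`-series form**: for `z, z̄ ∈ (0,1)` and `p, q > 1/2`,
`Σ_{n,ℓ} P_{n,ℓ}(p,q) (z z̄)^n K^{(a,a)}_{2s+2n+ℓ,ℓ}(z,z̄) = (1-z)^{-p}(1-z̄)^{-p}` (`a = (p-q)/2`, `s = (p+q)/2`).
[cite: FitzpatrickKaplan2012, §2.2] -/
theorem hasSum_mftII_series {p q : ℝ} (hp : 1 / 2 < p) (hq : 1 / 2 < q) {z zb : ℝ} (hz : z ∈ Ioo (0 : ℝ) 1)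
    (hzb : zb ∈ Ioo (0 : ℝ) 1) :
    HasSum (fun m : ℕ × ℕ => mftCoeffAB p q m.1 m.2 *
        ((z * zb) ^ m.1 * hrSeriesAB ((p - q) / 2) ((p - q) / 2) (2 * ((p + q) / 2) + 2 * m.1 + m.2) m.2 z zb))
      (1 / (1 - z) ^ p * (1 / (1 - zb) ^ p)) := by
  obtain ⟨_, htot⟩ := hasSum_mftIIFamily hp hq hz hzb
  have hswap : HasSum (fun mq : (ℕ × ℕ) × (ℕ × ℕ) => mftIIFamily p q z zb (mq.2, mq.1))
      (1 / (1 - z) ^ p * (1 / (1 - zb) ^ p)) :=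
    (Equiv.prodComm (ℕ × ℕ) (ℕ × ℕ)).hasSum_iff.mpr htot
  have hrow : ∀ m : ℕ × ℕ, HasSum (fun u : ℕ × ℕ => mftIIFamily p q z zb (u, m))
      (mftCoeffAB p q m.1 m.2 *
        ((z * zb) ^ m.1 * hrSeriesAB ((p - q) / 2) ((p - q) / 2) (2 * ((p + q) / 2) + 2 * m.1 + m.2) m.2 z zb)) := by
    intro m
    have h := (hasSum_hrMonomialCoeffAB_shift ((p - q) / 2) ((p - q) / 2) (pair_unitarity' hp hq m.1 m.2) m.1
      hz hzb).mul_left (mftCoeffAB p q m.1 m.2)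
    refine h.congr_fun fun u => ?_
    simp only [mftIIFamily]
  exact hswap.prod_fiberwise hrow

/-! ### 4b. The `u^s` family (I): absolute summability by the Cauchy–Schwarz bound, then fibrewise summation -/

/-- **Coefficient-level Cauchy–Schwarz bound at the monomial level**: strictly above the unitarity bound (and
`Δ ≠ 1` if `ℓ = 0`), `|k^{(a,-a)}_{mn}| ≤ (k^{(a,a)}_{mn} + k^{(-a,-a)}_{mn})/2` (from `abs_hrCoeffAB_neg_le`, the
Legendre arrays being non-negative). [cite: DolanOsborn2004, §3 eq. (3.11)] -/
theorem abs_hrMonomialCoeffAB_neg_le {a Δ : ℝ} {ℓ : ℕ} (hΔ : unitarityBound3D ℓ < Δ) (h1 : ℓ = 0 → Δ ≠ 1)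
    (u : ℕ × ℕ) :
    |hrMonomialCoeffAB a (-a) Δ ℓ u| ≤
      (hrMonomialCoeffAB a a Δ ℓ u + hrMonomialCoeffAB (-a) (-a) Δ ℓ u) / 2 := by
  unfold hrMonomialCoeffAB
  split_ifs with h
  · unfold hrSliceAB
    rw [← sum_add_distrib]
    refine (abs_sum_le_sum_abs _ _).trans ?_
    rw [Finset.sum_div]
    refine sum_le_sum fun j _ => ?_
    have hlam := legendreLam_pos ℓ
    have he := legendreArrDeg_nonneg (u.1 + u.2) j u
    rw [abs_mul, abs_div, abs_of_pos hlam, abs_of_nonneg he]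
    have hb := abs_hrCoeffAB_neg_le (a := a) hΔ h1 (u.1 + u.2 - ℓ) j
    calc |hrCoeffAB a (-a) Δ ℓ (u.1 + u.2 - ℓ) j| / legendreLam ℓ * legendreArrDeg (u.1 + u.2) j u
        ≤ (hrCoeffAB a a Δ ℓ (u.1 + u.2 - ℓ) j + hrCoeffAB (-a) (-a) Δ ℓ (u.1 + u.2 - ℓ) j) / 2 /
            legendreLam ℓ * legendreArrDeg (u.1 + u.2) j u :=
          mul_le_mul_of_nonneg_right (div_le_div_of_nonneg_right hb hlam.le) he
      _ = (hrCoeffAB a a Δ ℓ (u.1 + u.2 - ℓ) j / legendreLam ℓ * legendreArrDeg (u.1 + u.2) j u +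
            hrCoeffAB (-a) (-a) Δ ℓ (u.1 + u.2 - ℓ) j / legendreLam ℓ * legendreArrDeg (u.1 + u.2) j u) / 2 := by
          ring
  · simp

/-- The four-index family of the `⟨σεσε⟩` decomposition:
`(-1)^ℓ P_{n,ℓ}(p,q) · [n ≤ i,k] k^{(a,-a)}_{(2s+2n+ℓ,ℓ);(i-n,k-n)} · z^i z̄^k`, `a = (q-p)/2`. [folklore] -/
noncomputable def mftIFamily (p q z zb : ℝ) (qm : (ℕ × ℕ) × (ℕ × ℕ)) : ℝ :=
  (-1 : ℝ) ^ qm.2.2 * mftCoeffAB p q qm.2.1 qm.2.2 *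
    ((if qm.2.1 ≤ qm.1.1 ∧ qm.2.1 ≤ qm.1.2 then
        hrMonomialCoeffAB ((q - p) / 2) ((p - q) / 2) (2 * ((p + q) / 2) + 2 * qm.2.1 + qm.2.2) qm.2.2
          (qm.1.1 - qm.2.1, qm.1.2 - qm.2.1) else 0) *
      z ^ qm.1.1 * zb ^ qm.1.2)

/-- **Domination of the `⟨σεσε⟩` family** by the two `⟨εσσε⟩` families at `(q,p)` and `(p,q)`:
`|mftIFamily p q| ≤ (mftIIFamily q p + mftIIFamily p q)/2` termwise on the square. [folklore] -/
theorem abs_mftIFamily_le {p q : ℝ} (hp : 1 / 2 < p) (hq : 1 / 2 < q) {z zb : ℝ} (hz : 0 ≤ z) (hzb : 0 ≤ zb)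
    (qm : (ℕ × ℕ) × (ℕ × ℕ)) :
    |mftIFamily p q z zb qm| ≤ (mftIIFamily q p z zb qm + mftIIFamily p q z zb qm) / 2 := by
  simp only [mftIFamily, mftIIFamily]
  rw [mftCoeffAB_comm q p, show (q + p) / 2 = (p + q) / 2 by ring]
  have hC := mftCoeffAB_nonneg hp hq qm.2.1 qm.2.2
  have hzi := pow_nonneg hz qm.1.1
  have hzk := pow_nonneg hzb qm.1.2
  simp only [abs_mul, abs_pow, abs_neg, abs_one, one_pow, one_mul, abs_of_nonneg hC, abs_of_nonneg hz,
    abs_of_nonneg hzb]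
  split_ifs with hc
  · have hΔ := pair_unitarity' hp hq qm.2.1 qm.2.2
    have h1 : qm.2.2 = 0 → 2 * ((p + q) / 2) + 2 * (qm.2.1 : ℝ) + (qm.2.2 : ℝ) ≠ 1 := by
      intro _ h
      have hn : (0 : ℝ) ≤ qm.2.1 := Nat.cast_nonneg _
      have hl : (0 : ℝ) ≤ qm.2.2 := Nat.cast_nonneg _
      linarith
    have hb := abs_hrMonomialCoeffAB_neg_le (a := (q - p) / 2) hΔ h1 (qm.1.1 - qm.2.1, qm.1.2 - qm.2.1)
    rw [show -((q - p) / 2) = (p - q) / 2 by ring] at hb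
    have key : mftCoeffAB p q qm.2.1 qm.2.2 *
        (|hrMonomialCoeffAB ((q - p) / 2) ((p - q) / 2) (2 * ((p + q) / 2) + 2 * ↑qm.2.1 + ↑qm.2.2) qm.2.2
            (qm.1.1 - qm.2.1, qm.1.2 - qm.2.1)| * z ^ qm.1.1 * zb ^ qm.1.2) ≤
        mftCoeffAB p q qm.2.1 qm.2.2 *
          ((hrMonomialCoeffAB ((q - p) / 2) ((q - p) / 2) (2 * ((p + q) / 2) + 2 * ↑qm.2.1 + ↑qm.2.2) qm.2.2
              (qm.1.1 - qm.2.1, qm.1.2 - qm.2.1) +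
            hrMonomialCoeffAB ((p - q) / 2) ((p - q) / 2) (2 * ((p + q) / 2) + 2 * ↑qm.2.1 + ↑qm.2.2) qm.2.2
              (qm.1.1 - qm.2.1, qm.1.2 - qm.2.1)) / 2 * z ^ qm.1.1 * zb ^ qm.1.2) :=
      mul_le_mul_of_nonneg_left (mul_le_mul_of_nonneg_right (mul_le_mul_of_nonneg_right hb hzi) hzk) hC
    refine key.trans (le_of_eq ?_)
    ring
  · simp

/-- **The `⟨σεσε⟩` family is absolutely summable, with total `1`** (`z, z̄ ∈ (0,1)`, `p, q > 1/2`): summability from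
the domination `abs_mftIFamily_le` and `hasSum_mftIIFamily` at `(q,p)` and `(p,q)`; the total from fibrewise
summation and the degree identity `mftAB_degree_identity_I` (fibre sums `δ_{(i,k),(0,0)}`). [cite: FitzpatrickKaplan2012, §2.2] -/
theorem hasSum_mftIFamily {p q : ℝ} (hp : 1 / 2 < p) (hq : 1 / 2 < q) {z zb : ℝ} (hz : z ∈ Ioo (0 : ℝ) 1)
    (hzb : zb ∈ Ioo (0 : ℝ) 1) : HasSum (mftIFamily p q z zb) 1 := by
  set G := mftIFamily p q z zb with hG
  -- summability by domination
  have hS1 := (hasSum_mftIIFamily hq hp hz hzb).1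
  have hS2 := (hasSum_mftIIFamily hp hq hz hzb).1
  have hGsum : Summable G := by
    refine Summable.of_norm_bounded ((hS1.add hS2).div_const 2) fun qm => ?_
    rw [Real.norm_eq_abs]
    have h := abs_mftIFamily_le hp hq hz.1.le hzb.1.le qm
    simpa [Pi.add_apply] using h
  -- fibre sums over the operator index: the degree identity gives `δ`
  set V : ℕ × ℕ → ℝ := fun u => if u = (0, 0) then 1 else 0 with hV
  have hinner : ∀ u : ℕ × ℕ, HasSum (fun m => G (u, m)) (V u) := by
    intro u
    set N := u.1 + u.2 with hN
    have hzero : ∀ m ∉ range (N + 1) ×ˢ range (N + 1), G (u, m) = 0 := by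
      intro m hm
      rw [Finset.mem_product, Finset.mem_range, Finset.mem_range, not_and_or, not_lt, not_lt] at hm
      simp only [hG, mftIFamily]
      rcases hm with h1 | h2
      · rw [if_neg (by omega)]; ring
      · split_ifs with hc
        · rw [hrMonomialCoeffAB_eq_zero_of_lt _ _ _ _ (by simp only; omega)]; ring
        · ring
    have hfin : HasSum (fun m => G (u, m)) (∑ m ∈ range (N + 1) ×ˢ range (N + 1), G (u, m)) :=
      hasSum_sum_of_ne_finset_zero hzero
    have hval : ∑ m ∈ range (N + 1) ×ˢ range (N + 1), G (u, m) = V u := by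
      rw [Finset.sum_product, hV]
      have hδ : (if u = (0, 0) then (1 : ℝ) else 0) = (if N = 0 then 1 else 0) * (z ^ u.1 * zb ^ u.2) := by
        by_cases h0 : N = 0
        · have h1 : u.1 = 0 := by omega
          have h2 : u.2 = 0 := by omega
          have hu : u = (0, 0) := Prod.ext h1 h2
          rw [if_pos hu, if_pos h0, h1, h2]; simp
        · have hu : u ≠ (0, 0) := by
            intro hu; apply h0; rw [hN, hu]; rfl
          rw [if_neg hu, if_neg h0]; simp
      simp only
      rw [hδ, ← mftAB_degree_identity_I hp hq u.1 u.2 N hN.symm, sum_mul]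
      refine sum_congr rfl fun n _ => ?_
      rw [sum_mul]
      refine sum_congr rfl fun ℓ _ => ?_
      simp only [hG, mftIFamily]
      ring
    rwa [hval] at hfin
  have hVsum : HasSum V 1 := by
    have h : HasSum (fun u : ℕ × ℕ => if u = (0, 0) then (1 : ℝ) else 0) 1 := hasSum_ite_eq (0, 0) 1
    exact h
  have htot : HasSum G (∑' qm, G qm) := hGsum.hasSum
  have hval : ∑' qm, G qm = 1 := (htot.prod_fiberwise hinner).unique hVsum
  rwa [hval] at htot

/-- **The `⟨σεσε⟩` decomposition, `z`-series form**: for `z, z̄ ∈ (0,1)` and `p, q > 1/2`,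
`Σ_{n,ℓ} (-1)^ℓ P_{n,ℓ}(p,q) (z z̄)^n K^{(a,-a)}_{2s+2n+ℓ,ℓ}(z,z̄) = 1` (`a = (q-p)/2`, `s = (p+q)/2`).
[cite: FitzpatrickKaplan2012, §2.2] -/
theorem hasSum_mftI_series {p q : ℝ} (hp : 1 / 2 < p) (hq : 1 / 2 < q) {z zb : ℝ} (hz : z ∈ Ioo (0 : ℝ) 1)
    (hzb : zb ∈ Ioo (0 : ℝ) 1) :
    HasSum (fun m : ℕ × ℕ => (-1 : ℝ) ^ m.2 * mftCoeffAB p q m.1 m.2 *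
        ((z * zb) ^ m.1 * hrSeriesAB ((q - p) / 2) ((p - q) / 2) (2 * ((p + q) / 2) + 2 * m.1 + m.2) m.2 z zb))
      1 := by
  have htot := hasSum_mftIFamily hp hq hz hzb
  have hswap : HasSum (fun mq : (ℕ × ℕ) × (ℕ × ℕ) => mftIFamily p q z zb (mq.2, mq.1)) 1 :=
    (Equiv.prodComm (ℕ × ℕ) (ℕ × ℕ)).hasSum_iff.mpr htot
  have hrow : ∀ m : ℕ × ℕ, HasSum (fun u : ℕ × ℕ => mftIFamily p q z zb (u, m))
      ((-1 : ℝ) ^ m.2 * mftCoeffAB p q m.1 m.2 *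
        ((z * zb) ^ m.1 * hrSeriesAB ((q - p) / 2) ((p - q) / 2) (2 * ((p + q) / 2) + 2 * m.1 + m.2) m.2 z zb)) := by
    intro m
    have h := (hasSum_hrMonomialCoeffAB_shift ((q - p) / 2) ((p - q) / 2) (pair_unitarity' hp hq m.1 m.2) m.1
      hz hzb).mul_left ((-1 : ℝ) ^ m.2 * mftCoeffAB p q m.1 m.2)
    refine h.congr_fun fun u => ?_
    simp only [mftIFamily]
  exact hswap.prod_fiberwise hrow

/-! ### 5. The block forms -/

/-- Rewriting an odd-sector block of the pair as `(z z̄)^s` times its shifted `(a,b)` series: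
`g^{Δ₁₂,Δ₃₄}_{p+q+2n+ℓ,ℓ} = (z z̄)^{(p+q)/2} (z z̄)^n K^{(a,b)}`, `(a,b) = (-Δ₁₂/2, Δ₃₄/2)`. [cite: DolanOsborn2004, §3 eqs. (3.10)–(3.11)] -/
theorem hrBlockAB_pair_twist_eq (Δ₁₂ Δ₃₄ p q : ℝ) (n ℓ : ℕ) {z zb : ℝ} (hz : 0 < z) (hzb : 0 < zb) :
    hrBlockAB Δ₁₂ Δ₃₄ (p + q + 2 * n + ℓ) ℓ z zb =
      (z * zb) ^ ((p + q) / 2) *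
        ((z * zb) ^ n * hrSeriesAB (-Δ₁₂ / 2) (Δ₃₄ / 2) (2 * ((p + q) / 2) + 2 * n + ℓ) ℓ z zb) := by
  unfold hrBlockAB
  have hu : 0 < z * zb := mul_pos hz hzb
  have e : (p + q + 2 * (n : ℝ) + (ℓ : ℝ) - (ℓ : ℝ)) / 2 = (p + q) / 2 + (n : ℝ) := by ring
  have e' : 2 * ((p + q) / 2) + 2 * (n : ℝ) + (ℓ : ℝ) = p + q + 2 * (n : ℝ) + (ℓ : ℝ) := by ring
  rw [e, e', Real.rpow_add hu, Real.rpow_natCast]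
  ring

/-- **(I) `u^s = Σ_{n,ℓ} (-1)^ℓ P_{n,ℓ}(p,q) g^{Δ_σε,Δ_σε}_{p+q+2n+ℓ,ℓ}` on the open square** (`p, q > 1/2`,
`s = (p+q)/2`, `Δ_σε = p - q`): the conformal block decomposition of the ordering `⟨φχφχ⟩` of two decoupled
generalised free fields, in the typed blocks `hrBlockAB (p-q) (p-q)` (the `gmm` family of the `σ–ε` system).
[cite: FitzpatrickKaplan2012, §2.2] -/
theorem hasSum_gffPair_blocks_I {p q : ℝ} (hp : 1 / 2 < p) (hq : 1 / 2 < q) {z zb : ℝ} (hz : z ∈ Ioo (0 : ℝ) 1)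
    (hzb : zb ∈ Ioo (0 : ℝ) 1) :
    HasSum (fun nl : ℕ × ℕ => (-1 : ℝ) ^ nl.2 * mftCoeffAB p q nl.1 nl.2 *
        hrBlockAB (p - q) (p - q) (p + q + 2 * nl.1 + nl.2) nl.2 z zb) ((z * zb) ^ ((p + q) / 2)) := by
  have h := (hasSum_mftI_series hp hq hz hzb).mul_left ((z * zb) ^ ((p + q) / 2))
  rw [mul_one] at h
  refine h.congr_fun fun nl => ?_
  rw [hrBlockAB_pair_twist_eq (p - q) (p - q) p q nl.1 nl.2 hz.1 hzb.1,
    show -(p - q) / 2 = (q - p) / 2 by ring]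
  ring

/-- **(II) `u^s v^{-p} = Σ_{n,ℓ} P_{n,ℓ}(p,q) g^{-Δ_σε,Δ_σε}_{p+q+2n+ℓ,ℓ}` on the open square** (`p, q > 1/2`; all
coefficients positive): the conformal block decomposition of the reflection-positive ordering `⟨χφφχ⟩` of two
decoupled generalised free fields, in the typed blocks `hrBlockAB (-(p-q)) (p-q)` (the `gpm` family).
[cite: FitzpatrickKaplan2012, §2.2] -/
theorem hasSum_gffPair_blocks_II {p q : ℝ} (hp : 1 / 2 < p) (hq : 1 / 2 < q) {z zb : ℝ} (hz : z ∈ Ioo (0 : ℝ) 1)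
    (hzb : zb ∈ Ioo (0 : ℝ) 1) :
    HasSum (fun nl : ℕ × ℕ => mftCoeffAB p q nl.1 nl.2 *
        hrBlockAB (-(p - q)) (p - q) (p + q + 2 * nl.1 + nl.2) nl.2 z zb)
      ((z * zb) ^ ((p + q) / 2) / ((1 - z) * (1 - zb)) ^ p) := by
  have h := (hasSum_mftII_series hp hq hz hzb).mul_left ((z * zb) ^ ((p + q) / 2))
  have hval : (z * zb) ^ ((p + q) / 2) / ((1 - z) * (1 - zb)) ^ p =
      (z * zb) ^ ((p + q) / 2) * (1 / (1 - z) ^ p * (1 / (1 - zb) ^ p)) := by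
    rw [Real.mul_rpow (x := 1 - z) (y := 1 - zb) (sub_nonneg.mpr hz.2.le) (sub_nonneg.mpr hzb.2.le)]
    have h1 : 0 < (1 - z) ^ p := Real.rpow_pos_of_pos (by linarith [hz.2]) _
    have h2 : 0 < (1 - zb) ^ p := Real.rpow_pos_of_pos (by linarith [hzb.2]) _
    field_simp
  rw [hval]
  refine h.congr_fun fun nl => ?_
  rw [hrBlockAB_pair_twist_eq (-(p - q)) (p - q) p q nl.1 nl.2 hz.1 hzb.1,
    show -(-(p - q)) / 2 = (p - q) / 2 by ring]
  ring

/-! ### 6. The decoupled generalised-free pair on the quadrant and on the generalised-free segment -/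

/-- **Two decoupled generalised free fields `σ = φ` (dimension `p`), `ε = χ` (dimension `q`) as a `σ–ε` datum**
with the mean-field odd-sector coefficients `P_{n,ℓ}(p,q)`. [cite: FitzpatrickKaplan2012, §2.2] -/
noncomputable def gffPair (p q : ℝ) : SigmaEpsilonData := gffPairData p q (fun nl => mftCoeffAB p q nl.1 nl.2)

/-- Unfolding: `Δ_σ = p`. [folklore] -/
@[simp] theorem gffPair_Δσ (p q : ℝ) : (gffPair p q).Δσ = p := rfl

/-- Unfolding: `Δ_ε = q`. [folklore] -/
@[simp] theorem gffPair_Δε (p q : ℝ) : (gffPair p q).Δε = q := rfl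

/-- At `q = p` this is the datum of `DecoupledPairNonVacuity`. [folklore] -/
theorem gffPair_self (p : ℝ) : gffPair p p = decoupledPairData p := by
  unfold gffPair decoupledPairData
  congr 1
  funext nl
  exact mftCoeffAB_self p nl.1 nl.2

/-- **The decoupled generalised-free pair satisfies the FULL typed bootstrap axioms A1–A4** at
`(Δ_σ, Δ_ε) = (p, q)` for all `p, q > 1/2` in the A4 range `p + q ≥ 3`, `2q ≥ 3`, `2p ≥ 3 ∨ 2p = q`.
[cite: KosPolandSimmonsDuffinVichi2016, §2.1] -/
theorem gffPair_satisfiesBootstrapAxioms {p q : ℝ} (hp : 1 / 2 < p) (hq : 1 / 2 < q) (h3 : 3 ≤ p + q)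
    (hε : 3 ≤ 2 * q) (hσ : 3 ≤ 2 * p ∨ 2 * p = q) : (gffPair p q).SatisfiesBootstrapAxioms :=
  gffPairData_satisfiesBootstrapAxioms hp hq h3 hε hσ (fun nl => mftCoeffAB_nonneg hp hq nl.1 nl.2)
    (fun _ _ hz hzb => hasSum_gffPair_blocks_I hp hq hz hzb) (fun _ _ hz hzb => hasSum_gffPair_blocks_II hp hq hz hzb)

/-- **The whole closed quadrant `Δ_σ, Δ_ε ≥ 3/2` carries data satisfying A1–A4.** [cite: KosPolandSimmonsduffin2014, §5.3] -/
theorem gffPair_satisfiesBootstrapAxioms_of_ge {p q : ℝ} (hp : 3 / 2 ≤ p) (hq : 3 / 2 ≤ q) :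
    (gffPair p q).SatisfiesBootstrapAxioms :=
  gffPair_satisfiesBootstrapAxioms (by linarith) (by linarith) (by linarith) (by linarith) (Or.inl (by linarith))

/-- **The generalised-free segment `(Δ_σ, Δ_ε) = (p, 2p)`, `p ≥ 1`, carries data satisfying A1–A4** (realised by
the decoupled pair `(φ, χ_{2p})`; `[φφ]_{0,0}` sits exactly at `Δ_ε = 2p`, the odd scalars at `3p + 2n ≥ 3`).
[cite: KosPolandSimmonsduffin2014, §5.3] -/
theorem gffLine_satisfiesBootstrapAxioms {p : ℝ} (hp : 1 ≤ p) : (gffPair p (2 * p)).SatisfiesBootstrapAxioms :=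
  gffPair_satisfiesBootstrapAxioms (by linarith) (by linarith) (by linarith) (by linarith) (Or.inr rfl)

/-- For every point of the quadrant there is a datum satisfying A1–A4 with these external dimensions.
[cite: KosPolandSimmonsduffin2014, §5.3] -/
theorem exists_satisfiesBootstrapAxioms_of_ge {p q : ℝ} (hp : 3 / 2 ≤ p) (hq : 3 / 2 ≤ q) :
    ∃ D : SigmaEpsilonData, D.SatisfiesBootstrapAxioms ∧ D.Δσ = p ∧ D.Δε = q :=
  ⟨gffPair p q, gffPair_satisfiesBootstrapAxioms_of_ge hp hq, rfl, rfl⟩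

/-- **No excluded box meets the quadrant `[3/2, ∞)²`**: a certificate of ANY shape proving `BoxExcluded Q` over
the typed axioms cannot have `(p, q) ∈ Q` with `p, q ≥ 3/2` (the bulk region of the mixed-correlator numerics,
Kos–Poland–Simmons-Duffin 2014 §5.3, is filled by decoupled generalised free pairs). [cite: KosPolandSimmonsduffin2014, §5.3] -/
theorem BoxExcluded.not_mem_of_ge {Q : Set (ℝ × ℝ)} (h : BoxExcluded Q) {p q : ℝ} (hp : 3 / 2 ≤ p)
    (hq : 3 / 2 ≤ q) : (p, q) ∉ Q :=
  h (gffPair p q) (gffPair_satisfiesBootstrapAxioms_of_ge hp hq)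

/-- **No excluded box contains a point `(p, 2p)`, `p ≥ 1`, of the generalised-free line.**
[cite: KosPolandSimmonsduffin2014, §5.3] -/
theorem BoxExcluded.gffLine_not_mem {Q : Set (ℝ × ℝ)} (h : BoxExcluded Q) {p : ℝ} (hp : 1 ≤ p) :
    (p, 2 * p) ∉ Q :=
  h (gffPair p (2 * p)) (gffLine_satisfiesBootstrapAxioms hp)

/-- An excluded box is disjoint from the quadrant. [cite: KosPolandSimmonsduffin2014, §5.3] -/
theorem BoxExcluded.disjoint_quadrant {Q : Set (ℝ × ℝ)} (h : BoxExcluded Q) :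
    Disjoint Q (Ici (3 / 2 : ℝ) ×ˢ Ici (3 / 2 : ℝ)) := by
  rw [Set.disjoint_left]
  rintro ⟨p, q⟩ hQ ⟨hp, hq⟩
  exact h.not_mem_of_ge hp hq hQ

/-- Contrapositive: a box meeting the quadrant is not excluded. [cite: KosPolandSimmonsduffin2014, §5.3] -/
theorem not_boxExcluded_of_mem_of_ge {Q : Set (ℝ × ℝ)} {p q : ℝ} (hp : 3 / 2 ≤ p) (hq : 3 / 2 ≤ q)
    (hQ : (p, q) ∈ Q) : ¬ BoxExcluded Q :=
  fun h => h.not_mem_of_ge hp hq hQ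

/-- **Sanity constraint on enclosures**: an `IsingEnclosure W R` maps every quadrant point of its window into
its region, `W ∩ [3/2,∞)² ⊆ R`. (The tree's enclosures have windows `Δ_σ ≤ 0.6`.) [cite: KosPolandSimmonsduffin2014, §5.3] -/
theorem IsingEnclosure.mem_of_ge {W R : Set (ℝ × ℝ)} (h : IsingEnclosure W R) {p q : ℝ} (hp : 3 / 2 ≤ p)
    (hq : 3 / 2 ≤ q) (hW : (p, q) ∈ W) : (p, q) ∈ R :=
  h (gffPair p q) (gffPair_satisfiesBootstrapAxioms_of_ge hp hq) hW

/-- The same on the generalised-free segment: `(p, 2p) ∈ W`, `p ≥ 1` ⇒ `(p, 2p) ∈ R`. [cite: KosPolandSimmonsduffin2014, §5.3] -/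
theorem IsingEnclosure.gffLine_mem {W R : Set (ℝ × ℝ)} (h : IsingEnclosure W R) {p : ℝ} (hp : 1 ≤ p)
    (hW : (p, 2 * p) ∈ W) : (p, 2 * p) ∈ R :=
  h (gffPair p (2 * p)) (gffLine_satisfiesBootstrapAxioms hp) hW

/-- The window–region inclusion on the quadrant as a set statement. [cite: KosPolandSimmonsduffin2014, §5.3] -/
theorem IsingEnclosure.inter_quadrant_subset {W R : Set (ℝ × ℝ)} (h : IsingEnclosure W R) :
    W ∩ (Ici (3 / 2 : ℝ) ×ˢ Ici (3 / 2 : ℝ)) ⊆ R := by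
  rintro ⟨p, q⟩ ⟨hW, hp, hq⟩
  exact h.mem_of_ge hp hq hW

end Literature.MathematicalPhysics.QuantumFieldTheory.ConformalBootstrap3D
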